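import Literature.MathematicalPhysics.QuantumManyBody.BoseGasCutoffProduct
import Literature.MathematicalPhysics.QuantumManyBody.BoseGasHardLayerCutoff
import Literature.MathematicalPhysics.QuantumManyBody.PeriodicMaxFormApproximation
import Literature.MathematicalPhysics.QuantumManyBody.PeriodicMaxFormSimplicity
import HarnessLib

/-!
# MaxFormBound for hard cores, the cut-off step

Topic `Literature/MathematicalPhysics/QuantumManyBody`, sequel of `BoseGasCutoffProduct.lean`, `BoseGasHardLayerCutoff.lean` and
`PeriodicMaxFormApproximation.lean`. The variational principle `E₀(v) ‖ζ‖² ≤ Q_v(ζ)` for the maximal form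
`Q_v(ζ) = ∑ₙ (∑ₚ (2πnₚ/L)²)|⟪eₙ, ζ⟫|² + ∫ (W_v ∘ fromUnitTorusN L)|ζ|²` of the periodic `N`-body problem with a
finite-range pair potential `v` that may have hard cores, for every Bose-symmetric `ζ ∈ L²((ℝ/ℤ)^{3N})` whose mass in
the hard layers decays: `∫_{fromUnitTorusN L ⁻¹' hardLayer v L s} |ζ|² = o(s²)`
(`periodicGroundStateEnergy_mul_le_maxForm_of_layerDecay`). Proof: soften `v` off the `s/2`-neighbourhood of its hard
radii (`awayProfile`), approximate `ζ` in the softened maximal form by a Bose-symmetric trigonometric polynomial `P`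
(`exists_symm_trigPoly_maxForm_approx_general`), realise `P` as a core function `Ψ` (`exists_core_formEmbed_eq_sum_smul`),
multiply by the cut-off `ξ_s` of `exists_hardLayer_cutoff` and apply the core variational principle to `ξ_s Ψ`, whose
`v`-energy is the softened energy of `Ψ` up to `O(s⁻²) × (mass of P in the hard layer of width s) = o(1)`.

Tagged folklore (the `L¹_loc` case is B. Simon, J. Operator Theory 1 (1979) Thm. 2.1 / [ReedSimonIV1978] Thm. XIII.64).
-/

noncomputable section

open MeasureTheory Filter Set Complex UnitAddTorus Metric
open scoped ENNReal NNReal Topology InnerProductSpace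

namespace Literature.MathematicalPhysics.QuantumManyBody.BoseGas

-- The measure on `ℝ/ℤ` is the Haar PROBABILITY measure, as in `PeriodicFormDomain.lean`.
attribute [local instance] formDomain_measureSpace formDomain_isProbabilityMeasure formDomain_isProbabilityMeasure_pi

variable {N : ℕ} {L : ℝ} {v : ℝ → ℝ≥0∞}

/-- Local notation for the Hilbert space `L²((ℝ/ℤ)^{3N})`, as in `PeriodicFormDomain.lean`. -/
local notation "L2T " N':max => Lp ℂ 2 (volume : Measure (UnitAddTorus (Fin N' × Fin 3)))

namespace HardLayerAux

/-- The periodic interaction of a measurable profile is measurable (local copy). [folklore] -/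
theorem measurable_periodicInteraction_hc {v : ℝ → ℝ≥0∞} (hv : Measurable v) (L : ℝ) :
    Measurable (periodicInteraction (N := N) v L) := by
  unfold periodicInteraction periodizedPotential
  refine Finset.measurable_sum _ fun i _ => Finset.measurable_sum _ fun j _ => ?_
  exact (Measurable.tsum fun n => hv.comp (measurable_id.sub_const _).norm).comp
    ((measurable_config_apply i).sub (measurable_config_apply j))

/-- The free profile has no interaction. [folklore] -/
theorem periodicInteraction_zero_profile (L : ℝ) (X : Config N) : periodicInteraction (fun _ => (0 : ℝ≥0∞)) L X = 0 := by
  simp [periodicInteraction, periodizedPotential]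

/-- Indicator of a preimage times a function, integrated (local copy). [folklore] -/
theorem lintegral_indicator_preimage_mul' {A : Set (Config N)} (hA : MeasurableSet A) (L : ℝ)
    (F : UnitAddTorus (Fin N × Fin 3) → ℝ≥0∞) :
    ∫⁻ t, A.indicator (1 : Config N → ℝ≥0∞) (fromUnitTorusN L t) * F t = ∫⁻ t in fromUnitTorusN L ⁻¹' A, F t := by
  rw [← lintegral_indicator (hA.preimage (measurable_fromUnitTorusN L))]
  refine lintegral_congr fun t => ?_
  by_cases ht : fromUnitTorusN L t ∈ A
  · rw [indicator_of_mem ht, indicator_of_mem (show t ∈ fromUnitTorusN L ⁻¹' A from ht), Pi.one_apply, one_mul]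
  · rw [indicator_of_notMem ht, indicator_of_notMem (show t ∉ fromUnitTorusN L ⁻¹' A from ht), zero_mul]

/-- **The limiting step**: if `E (c - ε) ≤ (1 + ε) Q + ε` for all small `ε > 0` (`Q < ∞`), then `E c ≤ Q`. [folklore] -/
theorem mul_ofReal_le_of_forall_eps {E Q : ℝ≥0∞} {c : ℝ} (hQ : Q ≠ ⊤)
    (h : ∀ ε : ℝ, 0 < ε → ε < 1 → E * ENNReal.ofReal (c - ε) ≤ ENNReal.ofReal (1 + ε) * Q + ENNReal.ofReal ε) :
    E * ENNReal.ofReal c ≤ Q := by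
  rcases le_or_gt c 0 with hc | hc
  · rw [ENNReal.ofReal_of_nonpos hc, mul_zero]; exact zero_le
  by_cases hE : E = ⊤
  · exfalso
    have h1 := h (min (1 / 2) (c / 2)) (lt_min (by norm_num) (by linarith)) (by linarith [min_le_left (1 / 2 : ℝ) (c / 2)])
    rw [hE, ENNReal.top_mul (by rw [ne_eq, ENNReal.ofReal_eq_zero, not_le]; linarith [min_le_right (1 / 2 : ℝ) (c / 2)]),
      top_le_iff] at h1
    exact ENNReal.add_ne_top.2 ⟨ENNReal.mul_ne_top ENNReal.ofReal_ne_top hQ, ENNReal.ofReal_ne_top⟩ h1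
  have hf : Tendsto (fun ε : ℝ => E * ENNReal.ofReal (c - ε)) (𝓝[>] 0) (𝓝 (E * ENNReal.ofReal c)) := by
    refine ENNReal.Tendsto.const_mul ?_ (Or.inr hE)
    have : Tendsto (fun ε : ℝ => c - ε) (𝓝[>] 0) (𝓝 (c - 0)) :=
      (tendsto_const_nhds.sub tendsto_id).mono_left nhdsWithin_le_nhds
    rw [sub_zero] at this
    exact ENNReal.tendsto_ofReal this
  have hg : Tendsto (fun ε : ℝ => ENNReal.ofReal (1 + ε) * Q + ENNReal.ofReal ε) (𝓝[>] 0) (𝓝 Q) := by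
    have h1 : Tendsto (fun ε : ℝ => ENNReal.ofReal (1 + ε)) (𝓝[>] 0) (𝓝 1) := by
      have : Tendsto (fun ε : ℝ => 1 + ε) (𝓝[>] 0) (𝓝 (1 + 0)) :=
        (tendsto_const_nhds.add tendsto_id).mono_left nhdsWithin_le_nhds
      rw [add_zero] at this
      simpa using ENNReal.tendsto_ofReal this
    have h2 : Tendsto (fun ε : ℝ => ENNReal.ofReal ε) (𝓝[>] 0) (𝓝 0) := by
      simpa using ENNReal.tendsto_ofReal (tendsto_id.mono_left (nhdsWithin_le_nhds (a := (0 : ℝ)) (s := Ioi 0)))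
    have h3 := (ENNReal.Tendsto.mul_const h1 (Or.inr hQ)).add h2
    rwa [one_mul, add_zero] at h3
  refine le_of_tendsto_of_tendsto hf hg ?_
  filter_upwards [Ioo_mem_nhdsGT (show (0 : ℝ) < 1 by norm_num)] with ε hε using h ε hε.1 hε.2

end HardLayerAux

open HardLayerAux

/-- **The cut-off step (one `ε`).** Let `v` be measurable of finite range, `L > 0`, `ζ ∈ L²((ℝ/ℤ)^{3N})` Bose-symmetric
with hard-layer decay `∫_{fromUnitTorusN L ⁻¹' hardLayer v L s} |ζ|² ≤ ε' s²` for all small `s` (every `ε' > 0`).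
Then for every `ε > 0`, `E₀(v) · (‖ζ‖² - ε) ≤ (1 + ε) Q_v(ζ) + ε`. [cite: ReedSimonIV1978, Thm. XIII.64] -/
theorem periodicGroundStateEnergy_mul_le_maxForm_step (hL : 0 < L) (hv : Measurable v) {R₀ : ℝ}
    (hv0 : ∀ r, R₀ < r → v r = 0) (ζ : L2T N)
    (hsymm : ∀ (σ : Equiv.Perm (Fin N)) (n : Fin N × Fin 3 → ℤ),
      ⟪(mFourierLp 2 (fun p : Fin N × Fin 3 => n (σ p.1, p.2)) : L2T N), ζ⟫_ℂ = ⟪(mFourierLp 2 n : L2T N), ζ⟫_ℂ)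
    (hlayer : ∀ ε' : ℝ, 0 < ε' → ∃ s₀ : ℝ, 0 < s₀ ∧ ∀ s : ℝ, 0 < s → s ≤ s₀ →
      ∫⁻ t in fromUnitTorusN L ⁻¹' (hardLayer v L s : Set (Config N)),
        ((‖(ζ : UnitAddTorus (Fin N × Fin 3) → ℂ) t‖₊ : ℝ≥0∞)) ^ 2 ≤ ENNReal.ofReal (ε' * s ^ 2))
    {ε : ℝ} (hε : 0 < ε) :
    periodicGroundStateEnergy v N L * ENNReal.ofReal (‖ζ‖ ^ 2 - ε) ≤
      ENNReal.ofReal (1 + ε) *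
        ((∑' n : Fin N × Fin 3 → ℤ, ENNReal.ofReal (∑ p, (2 * Real.pi * (n p : ℝ) / L) ^ 2) *
            (‖⟪(mFourierLp 2 n : L2T N), ζ⟫_ℂ‖₊ : ℝ≥0∞) ^ 2) +
          ∫⁻ t, periodicInteraction v L (fromUnitTorusN L t) *
            (‖(ζ : UnitAddTorus (Fin N × Fin 3) → ℂ) t‖₊ : ℝ≥0∞) ^ 2) + ENNReal.ofReal ε := by
  classical
  obtain ⟨K, hKdef⟩ : ∃ K : ℝ≥0∞, K = ∑' n : Fin N × Fin 3 → ℤ, ENNReal.ofReal (∑ p, (2 * Real.pi * (n p : ℝ) / L) ^ 2) *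
      (‖⟪(mFourierLp 2 n : L2T N), ζ⟫_ℂ‖₊ : ℝ≥0∞) ^ 2 := ⟨_, rfl⟩
  obtain ⟨V, hVdef⟩ : ∃ V : ℝ≥0∞, V = ∫⁻ t, periodicInteraction v L (fromUnitTorusN L t) *
      (‖(ζ : UnitAddTorus (Fin N × Fin 3) → ℂ) t‖₊ : ℝ≥0∞) ^ 2 := ⟨_, rfl⟩
  rw [← hKdef, ← hVdef]
  obtain ⟨C, hC0, hcut⟩ := exists_hardLayer_cutoff (N := N) hL v
  obtain ⟨A₁, hA₁⟩ : ∃ A₁ : ℝ, A₁ = (1 + ε⁻¹) * (3 * N) * C ^ 2 := ⟨_, rfl⟩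
  have hA₁0 : 0 ≤ A₁ := by rw [hA₁]; positivity
  obtain ⟨ε', hε'⟩ : ∃ ε' : ℝ, ε' = ε / (8 * (A₁ + 1)) := ⟨_, rfl⟩
  have hε'0 : 0 < ε' := by rw [hε']; positivity
  obtain ⟨s₀, hs₀, hs₀layer⟩ := hlayer ε' hε'0
  obtain ⟨s, hsdef⟩ : ∃ s : ℝ, s = min (min s₀ L) 1 := ⟨_, rfl⟩
  have hs : 0 < s := by rw [hsdef]; exact lt_min (lt_min hs₀ hL) one_pos
  have hss₀ : s ≤ s₀ := by rw [hsdef]; exact (min_le_left _ _).trans (min_le_left _ _)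
  have hsL : s ≤ L := by rw [hsdef]; exact (min_le_left _ _).trans (min_le_right _ _)
  have hs1 : s ≤ 1 := by rw [hsdef]; exact min_le_right _ _
  have hJζ := hs₀layer s hs hss₀
  obtain ⟨ξ, hξdiff, hξper, hξsym, hξ01, hξ0, hξ1, hξD⟩ := hcut s hs hsL
  set w : ℝ → ℝ≥0∞ := awayProfile v (s / 2) with hwdef
  have hw : Measurable w := measurable_awayProfile hv _
  have hwv : ∀ r, w r ≤ v r := fun r => awayProfile_le v _ r
  have hWint : ∫⁻ X in cellN N L, periodicInteraction w L X ≠ ⊤ :=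
    lintegral_cellN_periodicInteraction_ne_top_of_lintegral_ne_top hL hw
      (lintegral_awayProfile_norm_ne_top hv0 (half_pos hs)) N
  obtain ⟨e, hedef⟩ : ∃ e : ℝ, e = min (ε / 8) (min (ε / (8 * (‖ζ‖ + 1))) (min 1 (s ^ 2 * ε / (8 * (A₁ + 1))))) := ⟨_, rfl⟩
  have he0 : 0 < e := by rw [hedef]; exact lt_min (by positivity) (lt_min (by positivity) (lt_min one_pos (by positivity)))
  have he8 : e ≤ ε / 8 := by rw [hedef]; exact min_le_left _ _
  have heζ : e ≤ ε / (8 * (‖ζ‖ + 1)) := by rw [hedef]; exact (min_le_right _ _).trans (min_le_left _ _)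
  have he1 : e ≤ 1 := by rw [hedef]; exact (min_le_right _ _).trans ((min_le_right _ _).trans (min_le_left _ _))
  have hes : e ≤ s ^ 2 * ε / (8 * (A₁ + 1)) := by
    rw [hedef]; exact (min_le_right _ _).trans ((min_le_right _ _).trans (min_le_right _ _))
  obtain ⟨S, a, hS, ha, hkin, hpot, hdist⟩ := exists_symm_trigPoly_maxForm_approx_general hL hw hWint ζ hsymm he0
  -- the polynomial as a core function (embedding built with the free profile)
  have hv₀ : Measurable (fun _ : ℝ => (0 : ℝ≥0∞)) := measurable_const
  have hW₀ : ∫⁻ X in cellN N L, periodicInteraction (fun _ : ℝ => (0 : ℝ≥0∞)) L X ≠ ⊤ := by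
    simp [periodicInteraction_zero_profile]
  obtain ⟨Ψc, hΨc⟩ := exists_core_formEmbed_eq_sum_smul hL hv₀ hW₀ hS ha
  set P : L2T N := ∑ m ∈ S, a m • (mFourierLp 2 m : L2T N) with hPdef
  -- the cut-off product
  set Φc : periodicCore N L := ⟨fun X => (ξ X : ℂ) * (Ψc : Config N → ℂ) X,
    ofReal_mul_mem_periodicCore hξdiff hξper hξsym Ψc.2⟩ with hΦc
  have hΨ1 : ContDiff ℝ 1 (Ψc : Config N → ℂ) := Ψc.2.1
  have hΦ1 : ContDiff ℝ 1 (Φc : Config N → ℂ) := Φc.2.1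
  set A : Set (Config N) := hardLayer v L s with hAdef
  have hAm : MeasurableSet A := measurableSet_hardLayer v L s
  have hfd0 : ∀ X ∉ A, fderiv ℝ ξ X = 0 := by
    intro X hX
    have hev : ξ =ᶠ[𝓝 X] fun _ => (1 : ℝ) := by
      filter_upwards [Metric.ball_mem_nhds X (show 0 < s / 10 by positivity)] with X' hX'
      refine hξ1 X hX X' fun i => ?_
      rw [← dist_eq_norm]
      exact (dist_pi_lt_iff (by positivity)).1 (mem_ball.1 hX') i
    rw [hev.fderiv_eq, fderiv_const_apply]
  have hξone : ∀ X ∉ A, ξ X = 1 := fun X hX => hξ1 X hX X fun i => by rw [sub_self, norm_zero]; positivity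
  have hξd : Differentiable ℝ ξ := hξdiff.differentiable one_ne_zero
  have hΨd : Differentiable ℝ (Ψc : Config N → ℂ) := hΨ1.differentiable one_ne_zero
  -- measurability facts
  have hWvm := measurable_periodicInteraction_hc (N := N) hv L
  have hWwm := measurable_periodicInteraction_hc (N := N) hw L
  have hIm : Measurable (A.indicator (1 : Config N → ℝ≥0∞)) := measurable_one.indicator hAm
  have hΨsqm : Measurable fun X : Config N => ((‖(Ψc : Config N → ℂ) X‖₊ : ℝ≥0∞)) ^ 2 :=
    hΨ1.continuous.measurable.nnnorm.coe_nnreal_ennreal.pow_const _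
  have hΦsqm : Measurable fun X : Config N => ((‖(Φc : Config N → ℂ) X‖₊ : ℝ≥0∞)) ^ 2 :=
    hΦ1.continuous.measurable.nnnorm.coe_nnreal_ennreal.pow_const _
  -- the dictionary between the torus and the cell
  have hvar := periodicGroundStateEnergy_mul_le_maxForm_core hL hv₀ hW₀ hv Φc
  rw [tsum_kinetic_formEmbed_graphEmbed hL hv₀ hW₀ Φc, lintegral_pot_formEmbed_graphEmbed hL hv₀ hW₀ Φc hWvm] at hvar
  have hKP : (∑' n : Fin N × Fin 3 → ℤ, ENNReal.ofReal (∑ p, (2 * Real.pi * (n p : ℝ) / L) ^ 2) *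
      (‖⟪(mFourierLp 2 n : L2T N), P⟫_ℂ‖₊ : ℝ≥0∞) ^ 2) = ∫⁻ X in cellN N L, kineticDensity (Ψc : Config N → ℂ) X := by
    rw [← hΨc]; exact tsum_kinetic_formEmbed_graphEmbed hL hv₀ hW₀ Ψc
  have hVP : ∫⁻ t, periodicInteraction w L (fromUnitTorusN L t) *
      (‖(P : UnitAddTorus (Fin N × Fin 3) → ℂ) t‖₊ : ℝ≥0∞) ^ 2 =
      ∫⁻ X in cellN N L, periodicInteraction w L X * (‖(Ψc : Config N → ℂ) X‖₊ : ℝ≥0∞) ^ 2 := by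
    rw [← hΨc]; exact lintegral_pot_formEmbed_graphEmbed hL hv₀ hW₀ Ψc hWwm
  have hJP : ∫⁻ t, A.indicator (1 : Config N → ℝ≥0∞) (fromUnitTorusN L t) *
      (‖(P : UnitAddTorus (Fin N × Fin 3) → ℂ) t‖₊ : ℝ≥0∞) ^ 2 =
      ∫⁻ X in cellN N L, A.indicator (1 : Config N → ℝ≥0∞) X * (‖(Ψc : Config N → ℂ) X‖₊ : ℝ≥0∞) ^ 2 := by
    rw [← hΨc]; exact lintegral_pot_formEmbed_graphEmbed hL hv₀ hW₀ Ψc hIm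
  have hNP : ENNReal.ofReal (‖P‖ ^ 2) = ∫⁻ X in cellN N L, (‖(Ψc : Config N → ℂ) X‖₊ : ℝ≥0∞) ^ 2 := by
    rw [← hΨc, norm_formEmbed_graphEmbed_sq hL hv₀ hW₀ Ψc,
      ENNReal.ofReal_toReal (lintegral_cellN_sq_lt_top L hΨ1.continuous).ne]
  have hNΦ : ENNReal.ofReal (‖formEmbed hL hv₀ hW₀ ⟨graphEmbed hL hv₀ hW₀ Φc, graphEmbed_mem_formDomain hL hv₀ hW₀ Φc⟩‖ ^ 2) =
      ∫⁻ X in cellN N L, (‖(Φc : Config N → ℂ) X‖₊ : ℝ≥0∞) ^ 2 := by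
    rw [norm_formEmbed_graphEmbed_sq hL hv₀ hW₀ Φc, ENNReal.ofReal_toReal (lintegral_cellN_sq_lt_top L hΦ1.continuous).ne]
  -- the Config-side estimates
  obtain ⟨cD, hcD⟩ : ∃ cD : ℝ, cD = (1 + ε⁻¹) * (3 * N) * (C / s) ^ 2 := ⟨_, rfl⟩
  have hcD0 : 0 ≤ cD := by rw [hcD]; positivity
  have hI1 : ∫⁻ X in cellN N L, kineticDensity (Φc : Config N → ℂ) X ≤
      ENNReal.ofReal (1 + ε) * (∫⁻ X in cellN N L, kineticDensity (Ψc : Config N → ℂ) X) +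
        ENNReal.ofReal cD * (∫⁻ X in cellN N L, A.indicator (1 : Config N → ℝ≥0∞) X * (‖(Ψc : Config N → ℂ) X‖₊ : ℝ≥0∞) ^ 2) := by
    calc ∫⁻ X in cellN N L, kineticDensity (Φc : Config N → ℂ) X
        ≤ ∫⁻ X in cellN N L, (ENNReal.ofReal (1 + ε) * kineticDensity (Ψc : Config N → ℂ) X +
            ENNReal.ofReal cD * A.indicator (1 : Config N → ℝ≥0∞) X * (‖(Ψc : Config N → ℂ) X‖₊ : ℝ≥0∞) ^ 2) :=
          lintegral_mono fun X => by rw [hcD]; exact kineticDensity_cutoff_mul_le hξd hΨd hξ01 hξD hfd0 hε X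
      _ = _ := by
          rw [lintegral_add_left ((measurable_kineticDensity_any _).const_mul _), lintegral_const_mul _
            (measurable_kineticDensity_any _)]
          simp only [mul_assoc]
          rw [lintegral_const_mul _ (show Measurable (fun X : Config N => A.indicator (1 : Config N → ℝ≥0∞) X *
            ((‖(Ψc : Config N → ℂ) X‖₊ : ℝ≥0∞) ^ 2)) from hIm.mul hΨsqm)]
  have hI2 : ∫⁻ X in cellN N L, periodicInteraction v L X * (‖(Φc : Config N → ℂ) X‖₊ : ℝ≥0∞) ^ 2 ≤
      ∫⁻ X in cellN N L, periodicInteraction w L X * (‖(Ψc : Config N → ℂ) X‖₊ : ℝ≥0∞) ^ 2 :=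
    lintegral_mono fun X => pot_ofReal_mul_le hξ01 hξ0 _ X
  have hI3 : ∫⁻ X in cellN N L, (‖(Ψc : Config N → ℂ) X‖₊ : ℝ≥0∞) ^ 2 ≤
      (∫⁻ X in cellN N L, (‖(Φc : Config N → ℂ) X‖₊ : ℝ≥0∞) ^ 2) +
        ∫⁻ X in cellN N L, A.indicator (1 : Config N → ℝ≥0∞) X * (‖(Ψc : Config N → ℂ) X‖₊ : ℝ≥0∞) ^ 2 := by
    calc ∫⁻ X in cellN N L, (‖(Ψc : Config N → ℂ) X‖₊ : ℝ≥0∞) ^ 2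
        ≤ ∫⁻ X in cellN N L, ((‖(Φc : Config N → ℂ) X‖₊ : ℝ≥0∞) ^ 2 +
            A.indicator (1 : Config N → ℝ≥0∞) X * (‖(Ψc : Config N → ℂ) X‖₊ : ℝ≥0∞) ^ 2) :=
          lintegral_mono fun X => nnnorm_sq_le_add_indicator (A := A) hξone _ X
      _ = _ := lintegral_add_left hΦsqm _
  -- the mass of `P` in the layer
  obtain ⟨J, hJdef⟩ : ∃ J : ℝ≥0∞, J = ∫⁻ t, A.indicator (1 : Config N → ℝ≥0∞) (fromUnitTorusN L t) *
      (‖(P : UnitAddTorus (Fin N × Fin 3) → ℂ) t‖₊ : ℝ≥0∞) ^ 2 := ⟨_, rfl⟩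
  rw [← hJdef] at hJP
  have htwo : ∀ x : ℝ, 0 ≤ x → (2 : ℝ≥0∞) * ENNReal.ofReal x = ENNReal.ofReal (2 * x) := fun x _ => by
    rw [ENNReal.ofReal_mul (by norm_num), ENNReal.ofReal_ofNat]
  have hJ : J ≤ 2 * ENNReal.ofReal (ε' * s ^ 2) + 2 * ENNReal.ofReal (e ^ 2) := by
    have hsub : ∀ᵐ t ∂(volume : Measure (UnitAddTorus (Fin N × Fin 3))),
        ((P - ζ : L2T N) : UnitAddTorus (Fin N × Fin 3) → ℂ) t =
          (P : UnitAddTorus (Fin N × Fin 3) → ℂ) t - (ζ : UnitAddTorus (Fin N × Fin 3) → ℂ) t := Lp.coeFn_sub P ζ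
    have h1 : J ≤ ∫⁻ t, (2 * (A.indicator (1 : Config N → ℝ≥0∞) (fromUnitTorusN L t) *
        (‖(ζ : UnitAddTorus (Fin N × Fin 3) → ℂ) t‖₊ : ℝ≥0∞) ^ 2) +
          2 * (‖((P - ζ : L2T N) : UnitAddTorus (Fin N × Fin 3) → ℂ) t‖₊ : ℝ≥0∞) ^ 2) := by
      rw [hJdef]
      refine lintegral_mono_ae (hsub.mono fun t ht => ?_)
      rw [ht]
      have hsq : ((‖(P : UnitAddTorus (Fin N × Fin 3) → ℂ) t‖₊ : ℝ≥0∞)) ^ 2 ≤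
          2 * (‖(ζ : UnitAddTorus (Fin N × Fin 3) → ℂ) t‖₊ : ℝ≥0∞) ^ 2 +
            2 * (‖(P : UnitAddTorus (Fin N × Fin 3) → ℂ) t - (ζ : UnitAddTorus (Fin N × Fin 3) → ℂ) t‖₊ : ℝ≥0∞) ^ 2 := by
        rw [coe_nnnorm_sq_eq_ofReal, coe_nnnorm_sq_eq_ofReal, coe_nnnorm_sq_eq_ofReal, htwo _ (sq_nonneg _),
          htwo _ (sq_nonneg _), ← ENNReal.ofReal_add (by positivity) (by positivity)]
        refine ENNReal.ofReal_le_ofReal ?_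
        have h := norm_add_le ((ζ : UnitAddTorus (Fin N × Fin 3) → ℂ) t)
          ((P : UnitAddTorus (Fin N × Fin 3) → ℂ) t - (ζ : UnitAddTorus (Fin N × Fin 3) → ℂ) t)
        rw [add_sub_cancel] at h
        have h' := pow_le_pow_left₀ (norm_nonneg _) h 2
        nlinarith [h', sq_nonneg (‖(ζ : UnitAddTorus (Fin N × Fin 3) → ℂ) t‖ -
          ‖(P : UnitAddTorus (Fin N × Fin 3) → ℂ) t - (ζ : UnitAddTorus (Fin N × Fin 3) → ℂ) t‖)]
      by_cases hA' : fromUnitTorusN L t ∈ A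
      · rw [indicator_of_mem hA', Pi.one_apply, one_mul, one_mul]; exact hsq
      · rw [indicator_of_notMem hA']
        simp
    have hζm : AEMeasurable (fun t => 2 * (A.indicator (1 : Config N → ℝ≥0∞) (fromUnitTorusN L t) *
        (‖(ζ : UnitAddTorus (Fin N × Fin 3) → ℂ) t‖₊ : ℝ≥0∞) ^ 2)) volume :=
      (((measurable_one.indicator hAm).comp (measurable_fromUnitTorusN L)).mul
        ((Lp.stronglyMeasurable ζ).measurable.nnnorm.coe_nnreal_ennreal.pow_const 2)).aemeasurable.const_mul _
    refine h1.trans ?_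
    rw [lintegral_add_left' hζm, lintegral_const_mul' _ _ (by norm_num), lintegral_const_mul' _ _ (by norm_num),
      lintegral_indicator_preimage_mul' hAm]
    refine add_le_add (mul_le_mul_right hJζ _) (mul_le_mul_right ?_ _)
    rw [← ENNReal.ofReal_toReal (norm_Lp_two_sq_eq_toReal (P - ζ)).2, ← (norm_Lp_two_sq_eq_toReal (P - ζ)).1]
    exact ENNReal.ofReal_le_ofReal (pow_le_pow_left₀ (norm_nonneg _) hdist 2)
  have hJtop : J ≠ ⊤ := ne_top_of_le_ne_top (by
    exact ENNReal.add_ne_top.2 ⟨ENNReal.mul_ne_top (by norm_num) ENNReal.ofReal_ne_top,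
      ENNReal.mul_ne_top (by norm_num) ENNReal.ofReal_ne_top⟩) hJ
  -- the error budget in the reals
  have herr_real : cD * (2 * (ε' * s ^ 2) + 2 * e ^ 2) + e ≤ ε := by
    have h1 : cD * (ε' * s ^ 2) = A₁ * ε' := by rw [hcD, hA₁]; field_simp
    have hA₁1 : 0 < A₁ + 1 := by linarith only [hA₁0]
    have h2 : A₁ * ε' ≤ ε / 8 := by
      rw [hε', mul_div_assoc', div_le_div_iff₀ (by linarith only [hA₁1]) (by norm_num)]
      nlinarith only [hA₁0, hε]
    have h3 : cD * e ^ 2 ≤ ε / 8 := by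
      have h4 : e ^ 2 ≤ e * (s ^ 2 * ε / (8 * (A₁ + 1))) := by
        rw [sq]; exact mul_le_mul_of_nonneg_left hes he0.le
      have h5 : cD * (s ^ 2 * ε / (8 * (A₁ + 1))) = A₁ * ε / (8 * (A₁ + 1)) := by rw [hcD, hA₁]; field_simp
      have h6 : A₁ * ε / (8 * (A₁ + 1)) ≤ ε / 8 := by
        rw [div_le_div_iff₀ (by linarith only [hA₁1]) (by norm_num)]; nlinarith only [hA₁0, hε]
      calc cD * e ^ 2 ≤ cD * (e * (s ^ 2 * ε / (8 * (A₁ + 1)))) := mul_le_mul_of_nonneg_left h4 hcD0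
        _ = e * (cD * (s ^ 2 * ε / (8 * (A₁ + 1)))) := by ring
        _ ≤ 1 * (ε / 8) := by rw [h5]; exact mul_le_mul he1 h6 (by positivity) zero_le_one
        _ = ε / 8 := one_mul _
    have h7 : cD * (2 * (ε' * s ^ 2) + 2 * e ^ 2) = 2 * (cD * (ε' * s ^ 2)) + 2 * (cD * e ^ 2) := by ring
    rw [h7, h1]
    linarith only [h2, h3, he8, hε]
  have herr : ENNReal.ofReal cD * (2 * ENNReal.ofReal (ε' * s ^ 2) + 2 * ENNReal.ofReal (e ^ 2)) + ENNReal.ofReal e ≤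
      ENNReal.ofReal ε := by
    rw [htwo _ (by positivity), htwo _ (by positivity), ← ENNReal.ofReal_add (by positivity) (by positivity),
      ← ENNReal.ofReal_mul hcD0, ← ENNReal.ofReal_add (by positivity) he0.le]
    exact ENNReal.ofReal_le_ofReal herr_real
  -- the main chain
  have hpotζ : ∫⁻ t, periodicInteraction w L (fromUnitTorusN L t) *
      (‖(ζ : UnitAddTorus (Fin N × Fin 3) → ℂ) t‖₊ : ℝ≥0∞) ^ 2 ≤ V := by
    rw [hVdef]
    exact lintegral_mono fun t => mul_le_mul_left (periodicInteraction_mono_profile hwv L _) _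
  have hmain : periodicGroundStateEnergy v N L *
      ENNReal.ofReal (‖formEmbed hL hv₀ hW₀ ⟨graphEmbed hL hv₀ hW₀ Φc, graphEmbed_mem_formDomain hL hv₀ hW₀ Φc⟩‖ ^ 2) ≤
      ENNReal.ofReal (1 + ε) * (K + V) + ENNReal.ofReal ε := by
    calc _ ≤ _ := hvar
      _ ≤ (ENNReal.ofReal (1 + ε) * (∫⁻ X in cellN N L, kineticDensity (Ψc : Config N → ℂ) X) +
            ENNReal.ofReal cD * (∫⁻ X in cellN N L, A.indicator (1 : Config N → ℝ≥0∞) X * (‖(Ψc : Config N → ℂ) X‖₊ : ℝ≥0∞) ^ 2)) +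
          ∫⁻ X in cellN N L, periodicInteraction w L X * (‖(Ψc : Config N → ℂ) X‖₊ : ℝ≥0∞) ^ 2 := add_le_add hI1 hI2
      _ = ENNReal.ofReal (1 + ε) * (∑' n : Fin N × Fin 3 → ℤ, ENNReal.ofReal (∑ p, (2 * Real.pi * (n p : ℝ) / L) ^ 2) *
            (‖⟪(mFourierLp 2 n : L2T N), P⟫_ℂ‖₊ : ℝ≥0∞) ^ 2) + ENNReal.ofReal cD * J +
          ∫⁻ t, periodicInteraction w L (fromUnitTorusN L t) * (‖(P : UnitAddTorus (Fin N × Fin 3) → ℂ) t‖₊ : ℝ≥0∞) ^ 2 := by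
          rw [hKP, hJP, hVP]
      _ ≤ ENNReal.ofReal (1 + ε) * K + ENNReal.ofReal cD * (2 * ENNReal.ofReal (ε' * s ^ 2) + 2 * ENNReal.ofReal (e ^ 2)) +
          (V + ENNReal.ofReal e) := by
          gcongr
          · rw [hKdef]; exact hkin
          · exact hpot.trans (add_le_add hpotζ le_rfl)
      _ = ENNReal.ofReal (1 + ε) * K + V +
          (ENNReal.ofReal cD * (2 * ENNReal.ofReal (ε' * s ^ 2) + 2 * ENNReal.ofReal (e ^ 2)) + ENNReal.ofReal e) := by ring
      _ ≤ ENNReal.ofReal (1 + ε) * K + ENNReal.ofReal (1 + ε) * V + ENNReal.ofReal ε := by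
          refine add_le_add (add_le_add le_rfl ?_) herr
          calc V = 1 * V := (one_mul V).symm
            _ ≤ ENNReal.ofReal (1 + ε) * V := by
                gcongr; rw [← ENNReal.ofReal_one]; exact ENNReal.ofReal_le_ofReal (by linarith)
      _ = ENNReal.ofReal (1 + ε) * (K + V) + ENNReal.ofReal ε := by ring
  -- the norm from below
  have hnorm : ENNReal.ofReal (‖ζ‖ ^ 2 - ε) ≤
      ENNReal.ofReal (‖formEmbed hL hv₀ hW₀ ⟨graphEmbed hL hv₀ hW₀ Φc, graphEmbed_mem_formDomain hL hv₀ hW₀ Φc⟩‖ ^ 2) := by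
    refine ENNReal.ofReal_le_ofReal ?_
    obtain ⟨nΦ, hnΦ⟩ : ∃ nΦ : ℝ,
        nΦ = ‖formEmbed hL hv₀ hW₀ ⟨graphEmbed hL hv₀ hW₀ Φc, graphEmbed_mem_formDomain hL hv₀ hW₀ Φc⟩‖ := ⟨_, rfl⟩
    rw [← hnΦ] at hNΦ ⊢
    have h1 : ENNReal.ofReal (‖P‖ ^ 2) ≤ ENNReal.ofReal (nΦ ^ 2) + J := by rw [hNP, hNΦ, hJP]; exact hI3
    have h2 : ‖P‖ ^ 2 ≤ nΦ ^ 2 + J.toReal := by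
      have := ENNReal.toReal_mono (ENNReal.add_ne_top.2 ⟨ENNReal.ofReal_ne_top, hJtop⟩) h1
      rwa [ENNReal.toReal_ofReal (sq_nonneg _), ENNReal.toReal_add ENNReal.ofReal_ne_top hJtop,
        ENNReal.toReal_ofReal (sq_nonneg _)] at this
    have h3 : J.toReal ≤ 2 * (ε' * s ^ 2) + 2 * e ^ 2 := by
      have := ENNReal.toReal_mono (ENNReal.add_ne_top.2 ⟨ENNReal.mul_ne_top (by norm_num) ENNReal.ofReal_ne_top,
        ENNReal.mul_ne_top (by norm_num) ENNReal.ofReal_ne_top⟩) hJ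
      rwa [ENNReal.toReal_add (ENNReal.mul_ne_top (by norm_num) ENNReal.ofReal_ne_top)
        (ENNReal.mul_ne_top (by norm_num) ENNReal.ofReal_ne_top), ENNReal.toReal_mul, ENNReal.toReal_mul,
        ENNReal.toReal_ofReal (by positivity), ENNReal.toReal_ofReal (by positivity), ENNReal.toReal_ofNat] at this
    have h4 : ‖ζ‖ - e ≤ ‖P‖ := by
      have := (abs_le.1 (abs_norm_sub_norm_le P ζ)).1
      linarith only [this, hdist]
    have hee : e ^ 2 ≤ e := by rw [sq]; exact mul_le_of_le_one_left he0.le he1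
    have hA₁1 : 0 < A₁ + 1 := by linarith only [hA₁0]
    have h5 : 2 * (ε' * s ^ 2) ≤ ε / 4 := by
      have hs2 : s ^ 2 ≤ 1 := pow_le_one₀ hs.le hs1
      have hε'le : ε' ≤ ε / 8 := by
        rw [hε', div_le_div_iff₀ (by linarith only [hA₁1]) (by norm_num)]
        nlinarith only [hA₁0, hε]
      have := mul_le_mul_of_nonneg_left hs2 hε'0.le
      linarith only [this, hε'le]
    have h6 : 2 * e ^ 2 ≤ ε / 4 := by linarith only [hee, he8]
    have h7 : 2 * e * ‖ζ‖ ≤ ε / 4 := by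
      have hz1 : (0 : ℝ) < 8 * (‖ζ‖ + 1) := by linarith only [norm_nonneg ζ]
      have := (le_div_iff₀ hz1).1 heζ
      have h8e : 0 ≤ e := he0.le
      nlinarith only [norm_nonneg ζ, h8e, this]
    rcases le_or_gt ‖ζ‖ e with hζe | hζe
    · have : ‖ζ‖ ^ 2 ≤ e ^ 2 := pow_le_pow_left₀ (norm_nonneg _) hζe 2
      linarith only [this, hee, he8, sq_nonneg nΦ, hε]
    · have h8 : (‖ζ‖ - e) ^ 2 ≤ ‖P‖ ^ 2 := pow_le_pow_left₀ (by linarith only [hζe]) h4 2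
      have h9 : (‖ζ‖ - e) ^ 2 = ‖ζ‖ ^ 2 - 2 * e * ‖ζ‖ + e ^ 2 := by ring
      linarith only [h8, h2, h3, h5, h6, h7, h9, sq_nonneg e]
  -- conclusion
  calc periodicGroundStateEnergy v N L * ENNReal.ofReal (‖ζ‖ ^ 2 - ε)
      ≤ periodicGroundStateEnergy v N L *
          ENNReal.ofReal (‖formEmbed hL hv₀ hW₀ ⟨graphEmbed hL hv₀ hW₀ Φc, graphEmbed_mem_formDomain hL hv₀ hW₀ Φc⟩‖ ^ 2) :=
        mul_le_mul_right hnorm _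
    _ ≤ _ := hmain

/-- **MaxFormBound under hard-layer decay.** In the setting of `periodicGroundStateEnergy_mul_le_maxForm_step`:
`E₀(v) · ‖ζ‖² ≤ Q_v(ζ)`. [cite: ReedSimonIV1978, Thm. XIII.64] -/
theorem periodicGroundStateEnergy_mul_le_maxForm_of_layerDecay (hL : 0 < L) (hv : Measurable v) {R₀ : ℝ}
    (hv0 : ∀ r, R₀ < r → v r = 0) (ζ : L2T N)
    (hsymm : ∀ (σ : Equiv.Perm (Fin N)) (n : Fin N × Fin 3 → ℤ),
      ⟪(mFourierLp 2 (fun p : Fin N × Fin 3 => n (σ p.1, p.2)) : L2T N), ζ⟫_ℂ = ⟪(mFourierLp 2 n : L2T N), ζ⟫_ℂ)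
    (hlayer : ∀ ε' : ℝ, 0 < ε' → ∃ s₀ : ℝ, 0 < s₀ ∧ ∀ s : ℝ, 0 < s → s ≤ s₀ →
      ∫⁻ t in fromUnitTorusN L ⁻¹' (hardLayer v L s : Set (Config N)),
        ((‖(ζ : UnitAddTorus (Fin N × Fin 3) → ℂ) t‖₊ : ℝ≥0∞)) ^ 2 ≤ ENNReal.ofReal (ε' * s ^ 2)) :
    periodicGroundStateEnergy v N L * ENNReal.ofReal (‖ζ‖ ^ 2) ≤
      (∑' n : Fin N × Fin 3 → ℤ, ENNReal.ofReal (∑ p, (2 * Real.pi * (n p : ℝ) / L) ^ 2) *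
          (‖⟪(mFourierLp 2 n : L2T N), ζ⟫_ℂ‖₊ : ℝ≥0∞) ^ 2) +
        ∫⁻ t, periodicInteraction v L (fromUnitTorusN L t) *
          (‖(ζ : UnitAddTorus (Fin N × Fin 3) → ℂ) t‖₊ : ℝ≥0∞) ^ 2 := by
  by_cases hQ : (∑' n : Fin N × Fin 3 → ℤ, ENNReal.ofReal (∑ p, (2 * Real.pi * (n p : ℝ) / L) ^ 2) *
      (‖⟪(mFourierLp 2 n : L2T N), ζ⟫_ℂ‖₊ : ℝ≥0∞) ^ 2) +
      ∫⁻ t, periodicInteraction v L (fromUnitTorusN L t) * (‖(ζ : UnitAddTorus (Fin N × Fin 3) → ℂ) t‖₊ : ℝ≥0∞) ^ 2 = ⊤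
  · rw [hQ]; exact le_top
  exact mul_ofReal_le_of_forall_eps hQ fun ε hε _ =>
    periodicGroundStateEnergy_mul_le_maxForm_step hL hv hv0 ζ hsymm hlayer hε

end Literature.MathematicalPhysics.QuantumManyBody.BoseGas

end
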